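import Summits.ResolutionOfSingularities.ResolutionOfSingularities.Theorems.WeightedInvariantIota3SigmaDescentSX
import Mathlib.RingTheory.Ideal.Cotangent
import Mathlib.LinearAlgebra.Dual.Lemmas
import HarnessLib

/-!
# Flags of `S(X)` with polynomial members SPECIALISE when the residue field is infinite ((o39) sequel, (D-b)(5))

Route `ResolutionOfSingularities/WeightedInvariant`, crux `Theses.WeightedInvariant.HypersurfaceCentreConstruction`
(stmt-ResolutionOfSingularities-19897), P3 rung, clause (c10σ); res-L1-w43-plan-1 RULING gen 11 #5 (2) Q2; design note
`plan/tools/res-type-057/SIGMA-DESCENT-SX.md` §UPDATE (res-type-057).  This file DISCHARGES the hypothesis `hspec` of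
`WeightedInvariantIota3SigmaDescentSX` (p538474) for local rings `S` with INFINITE residue field `κ`:

* (★) `isTwoFlag_genericFibre_polynomial` — a two-flag `(G₁/1, G₂/1)` of `S(X) = S[X]_{𝔪S[X]}` with `G₁ G₂ ∈ S[X]` satisfies the
  polynomial flag condition `P₁ G₁ + P₂ G₂ ∈ 𝔪²S[X] ⇒ P₁, P₂ ∈ 𝔪S[X]`;
* cotangent functionals `θ : S → κ` (additive and `κ`-semilinear on `𝔪`, killing `𝔪²`; concretely `φ ∘ toCotangent` for
  `φ ∈ (𝔪/𝔪²)^*`, `exists_cotangentFunctional_ne_zero`) transform `G ∈ 𝔪S[X]` into `θG ∈ κ[X]` coefficientwise, compatibly with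
  specialisation (`cotangentFunctional_aeval`) and with multiplication by `S[X]` (`cotangentFunctional_coeff_mul`);
* the `2×2` minor `Δ = θG₁·ψG₂ − θG₂·ψG₁ ∈ κ[X]` of two functionals is NONZERO for a suitable pair (`exists_minor_ne_zero`, from (★)),
  and `(G₁(a), G₂(a))` is a two-flag of `S` whenever `Δ(ā) ≠ 0` (`isTwoFlag_aeval_of_minor_ne_zero`);
* hence (`isTwoFlag_specialises_of_infinite`) flags specialise off a finite set of residues, and with p538474:
  **`iotaSigma_genericFibre_eq` — `σ` is PRESERVED along `S → S(X)` for every local ring `S` with infinite residue field**, and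
  `FlagReaches` descends (`FlagReaches.of_genericFibre`).

Finite residue fields are NOT covered (there the descent goes through a finite separable residue extension, (D-c)).
Def-free helper (`--supports stmt-ResolutionOfSingularities-19897`); OURS bookkeeping; no claim about resolution in positive characteristic.
AI-written; weaker than expert review.  [OURS · L1 W4.3 · (o39) sequel]  [cite: Matsumura1987, §8]
-/

noncomputable section

set_option linter.dupNamespace false -- mandated namespace of this single-conjunct summit

open IsLocalRing Polynomial Literature.AlgebraicGeometry.Resolution
open Summit.ResolutionOfSingularities.ResolutionOfSingularities.Theorems

namespace Summit.ResolutionOfSingularities.ResolutionOfSingularities.Cruxes.HypersurfaceCentreConstruction.LocalEngine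

namespace Iota3

section PolynomialFlag

variable {S : Type} [CommRing S] [IsLocalRing S]

/-- A polynomial in `𝔪S[X]` has residue polynomial `0`. [folklore] -/
theorem map_residue_eq_zero_of_mem {P : S[X]} (hP : P ∈ (maximalIdeal S).map (C : S →+* S[X])) :
    P.map (residue S) = 0 := by
  ext n
  rw [Polynomial.coeff_map, Polynomial.coeff_zero]
  exact (IsLocalRing.residue_eq_zero_iff _).mpr ((Ideal.mem_map_C_iff.mp hP) n)

/-- (★) **A two-flag of `S(X)` with polynomial members satisfies the polynomial flag condition**: `G₁, G₂ ∈ 𝔪S[X]` and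
`P₁ G₁ + P₂ G₂ ∈ 𝔪²S[X] ⇒ P₁, P₂ ∈ 𝔪S[X]`. [folklore] -/
theorem isTwoFlag_genericFibre_polynomial {G₁ G₂ : S[X]}
    (h : IsTwoFlag (algebraMap S[X] (Localization.AtPrime ((maximalIdeal S).map (C : S →+* S[X]))) G₁)
      (algebraMap S[X] (Localization.AtPrime ((maximalIdeal S).map (C : S →+* S[X]))) G₂)) :
    G₁ ∈ (maximalIdeal S).map (C : S →+* S[X]) ∧ G₂ ∈ (maximalIdeal S).map (C : S →+* S[X]) ∧
      ∀ P₁ P₂ : S[X], P₁ * G₁ + P₂ * G₂ ∈ (maximalIdeal S ^ 2).map (C : S →+* S[X]) →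
        P₁ ∈ (maximalIdeal S).map (C : S →+* S[X]) ∧ P₂ ∈ (maximalIdeal S).map (C : S →+* S[X]) := by
  have hmem : ∀ x : S[X], algebraMap S[X] (Localization.AtPrime ((maximalIdeal S).map (C : S →+* S[X]))) x ∈
      maximalIdeal (Localization.AtPrime ((maximalIdeal S).map (C : S →+* S[X]))) ↔ x ∈ (maximalIdeal S).map (C : S →+* S[X]) :=
    fun x => IsLocalization.AtPrime.to_map_mem_maximal_iff _ ((maximalIdeal S).map (C : S →+* S[X])) x
  refine ⟨(hmem G₁).mp h.1, (hmem G₂).mp h.2.1, fun P₁ P₂ hP => ?_⟩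
  have h2 : algebraMap S[X] (Localization.AtPrime ((maximalIdeal S).map (C : S →+* S[X]))) P₁ *
        algebraMap S[X] (Localization.AtPrime ((maximalIdeal S).map (C : S →+* S[X]))) G₁ +
      algebraMap S[X] (Localization.AtPrime ((maximalIdeal S).map (C : S →+* S[X]))) P₂ *
        algebraMap S[X] (Localization.AtPrime ((maximalIdeal S).map (C : S →+* S[X]))) G₂ ∈
      maximalIdeal (Localization.AtPrime ((maximalIdeal S).map (C : S →+* S[X]))) ^ 2 := by
    rw [← map_mul, ← map_mul, ← map_add, ← Localization.AtPrime.map_eq_maximalIdeal, ← Ideal.map_pow]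
    apply Ideal.mem_map_of_mem
    rwa [← Ideal.map_pow]
  obtain ⟨h₁, h₂⟩ := h.2.2 _ _ h2
  exact ⟨(hmem P₁).mp h₁, (hmem P₂).mp h₂⟩

end PolynomialFlag

section CotangentFunctional

variable {S : Type} [CommRing S] [IsLocalRing S]

/-- A cotangent functional vanishes at `0`. [folklore] -/
theorem cotangentFunctional_zero {θ : S → ResidueField S}
    (hmul : ∀ s x : S, x ∈ maximalIdeal S → θ (s * x) = residue S s * θ x) : θ 0 = 0 := by
  have h := hmul 0 0 (zero_mem _)
  rwa [zero_mul, map_zero, zero_mul] at h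

/-- A cotangent functional is additive over finite sums of elements of `𝔪`. [folklore] -/
theorem cotangentFunctional_sum {θ : S → ResidueField S}
    (hadd : ∀ x y : S, x ∈ maximalIdeal S → y ∈ maximalIdeal S → θ (x + y) = θ x + θ y)
    (hmul : ∀ s x : S, x ∈ maximalIdeal S → θ (s * x) = residue S s * θ x)
    {ι : Type*} (T : Finset ι) (u : ι → S) (hu : ∀ i ∈ T, u i ∈ maximalIdeal S) :
    θ (∑ i ∈ T, u i) = ∑ i ∈ T, θ (u i) := by
  classical
  induction T using Finset.induction_on with
  | empty => rw [Finset.sum_empty, Finset.sum_empty, cotangentFunctional_zero hmul]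
  | insert j T hj ih =>
    rw [Finset.sum_insert hj, Finset.sum_insert hj,
      hadd _ _ (hu j (Finset.mem_insert_self j T))
        (Ideal.sum_mem _ fun i hi => hu i (Finset.mem_insert_of_mem hi)),
      ih fun i hi => hu i (Finset.mem_insert_of_mem hi)]

/-- A cotangent functional is subtractive on `𝔪`. [folklore] -/
theorem cotangentFunctional_sub {θ : S → ResidueField S}
    (hadd : ∀ x y : S, x ∈ maximalIdeal S → y ∈ maximalIdeal S → θ (x + y) = θ x + θ y)
    (hmul : ∀ s x : S, x ∈ maximalIdeal S → θ (s * x) = residue S s * θ x)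
    {x y : S} (hx : x ∈ maximalIdeal S) (hy : y ∈ maximalIdeal S) : θ (x - y) = θ x - θ y := by
  rw [sub_eq_add_neg, ← neg_one_mul, hadd _ _ hx (Ideal.mul_mem_left _ _ hy), hmul _ _ hy, map_neg, map_one,
    neg_one_mul, sub_eq_add_neg]

/-- The coefficientwise transform `θG ∈ κ[X]` of `G ∈ S[X]` exists. [folklore] -/
theorem exists_cotangentFunctional_transform {θ : S → ResidueField S}
    (hmul : ∀ s x : S, x ∈ maximalIdeal S → θ (s * x) = residue S s * θ x) (G : S[X]) :
    ∃ P : (ResidueField S)[X], ∀ n, P.coeff n = θ (G.coeff n) := by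
  refine ⟨∑ n ∈ Finset.range (G.natDegree + 1), C (θ (G.coeff n)) * X ^ n, fun n => ?_⟩
  rw [Polynomial.finsetSum_coeff]
  simp only [Polynomial.coeff_C_mul_X_pow]
  rw [Finset.sum_ite_eq]
  split_ifs with hn
  · rfl
  · rw [Finset.mem_range, not_lt] at hn
    rw [Polynomial.coeff_eq_zero_of_natDegree_lt (Nat.lt_of_succ_le hn), cotangentFunctional_zero hmul]

/-- **Transform and specialisation commute**: `θ(G(a)) = θG(ā)` for `G ∈ 𝔪S[X]`. [folklore] -/
theorem cotangentFunctional_aeval {θ : S → ResidueField S}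
    (hadd : ∀ x y : S, x ∈ maximalIdeal S → y ∈ maximalIdeal S → θ (x + y) = θ x + θ y)
    (hmul : ∀ s x : S, x ∈ maximalIdeal S → θ (s * x) = residue S s * θ x)
    {G : S[X]} (hG : G ∈ (maximalIdeal S).map (C : S →+* S[X])) {P : (ResidueField S)[X]}
    (hP : ∀ n, P.coeff n = θ (G.coeff n)) (a : S) :
    θ (Polynomial.aeval a G) = P.eval (residue S a) := by
  have hGc := Ideal.mem_map_C_iff.mp hG
  have hdeg : P.natDegree < G.natDegree + 1 := by
    refine Nat.lt_succ_of_le ((Polynomial.natDegree_le_iff_coeff_eq_zero).mpr fun i hi => ?_)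
    rw [hP, Polynomial.coeff_eq_zero_of_natDegree_lt (by exact_mod_cast hi), cotangentFunctional_zero hmul]
  rw [Polynomial.aeval_eq_sum_range, Polynomial.eval_eq_sum_range' hdeg,
    cotangentFunctional_sum hadd hmul _ _ fun i _ => ?_]
  · refine Finset.sum_congr rfl fun i _ => ?_
    rw [smul_eq_mul, mul_comm, hmul _ _ (hGc i), map_pow, hP, mul_comm]
  · rw [smul_eq_mul]
    exact Ideal.mul_mem_right _ _ (hGc i)

/-- **Transform is `S[X]`-semilinear**: the coefficients of `θ(P·G)` are those of `P̄ · θG` for `G ∈ 𝔪S[X]`. [folklore] -/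
theorem cotangentFunctional_coeff_mul {θ : S → ResidueField S}
    (hadd : ∀ x y : S, x ∈ maximalIdeal S → y ∈ maximalIdeal S → θ (x + y) = θ x + θ y)
    (hmul : ∀ s x : S, x ∈ maximalIdeal S → θ (s * x) = residue S s * θ x)
    (P : S[X]) {G : S[X]} (hG : G ∈ (maximalIdeal S).map (C : S →+* S[X])) {Q : (ResidueField S)[X]}
    (hQ : ∀ n, Q.coeff n = θ (G.coeff n)) (n : ℕ) :
    θ ((P * G).coeff n) = (P.map (residue S) * Q).coeff n := by
  have hGc := Ideal.mem_map_C_iff.mp hG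
  rw [Polynomial.coeff_mul, Polynomial.coeff_mul,
    cotangentFunctional_sum hadd hmul _ _ fun x _ => Ideal.mul_mem_left _ _ (hGc x.2)]
  refine Finset.sum_congr rfl fun x _ => ?_
  rw [hmul _ _ (hGc x.2), Polynomial.coeff_map, hQ]

/-- **Cotangent functionals separate `𝔪/𝔪²`**: for `x ∈ 𝔪 ∖ 𝔪²` some cotangent functional (a linear form on the cotangent space
composed with the class map, extended by `0` off `𝔪`) does not vanish at `x`. [folklore] -/
theorem exists_cotangentFunctional_ne_zero {x : S} (hx : x ∈ maximalIdeal S) (hx2 : x ∉ maximalIdeal S ^ 2) :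
    ∃ θ : S → ResidueField S,
      (∀ y z : S, y ∈ maximalIdeal S → z ∈ maximalIdeal S → θ (y + z) = θ y + θ z) ∧
      (∀ s y : S, y ∈ maximalIdeal S → θ (s * y) = residue S s * θ y) ∧
      (∀ y ∈ maximalIdeal S ^ 2, θ y = 0) ∧ θ x ≠ 0 := by
  classical
  have hv : (maximalIdeal S).toCotangent ⟨x, hx⟩ ≠ 0 := by
    rw [Ne, Ideal.toCotangent_eq_zero]
    exact hx2
  obtain ⟨φ, hφ⟩ := Module.Projective.exists_dual_ne_zero (ResidueField S) hv
  refine ⟨fun y => if hy : y ∈ maximalIdeal S then φ ((maximalIdeal S).toCotangent ⟨y, hy⟩) else 0,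
    fun y z hy hz => ?_, fun s y hy => ?_, fun y hy => ?_, ?_⟩
  · have hyz : y + z ∈ maximalIdeal S := add_mem hy hz
    simp only [dif_pos hy, dif_pos hz, dif_pos hyz]
    rw [← map_add, ← map_add]
    rfl
  · have hsy : s * y ∈ maximalIdeal S := Ideal.mul_mem_left _ _ hy
    simp only [dif_pos hy, dif_pos hsy]
    have hsm : (⟨s * y, hsy⟩ : maximalIdeal S) = s • ⟨y, hy⟩ := rfl
    rw [hsm, map_smul, ← algebraMap_smul (ResidueField S) s, map_smul, smul_eq_mul]
    rfl
  · have hy1 : y ∈ maximalIdeal S := Ideal.pow_le_self two_ne_zero hy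
    simp only [dif_pos hy1]
    rw [(Ideal.toCotangent_eq_zero _ _).mpr hy, map_zero]
  · simp only [dif_pos hx]
    exact hφ

end CotangentFunctional

section Minor

variable {S : Type} [CommRing S] [IsLocalRing S]

/-- **Off the zeros of a cotangent minor the specialised pair is a two-flag**: if `θ, ψ` are cotangent functionals and
`Δ(ā) = θG₁(ā)·ψG₂(ā) − θG₂(ā)·ψG₁(ā) ≠ 0`, then `(G₁(a), G₂(a))` is a two-flag of `S`. [folklore] -/
theorem isTwoFlag_aeval_of_minor_ne_zero {θ ψ : S → ResidueField S}
    (hθadd : ∀ x y : S, x ∈ maximalIdeal S → y ∈ maximalIdeal S → θ (x + y) = θ x + θ y)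
    (hθmul : ∀ s x : S, x ∈ maximalIdeal S → θ (s * x) = residue S s * θ x)
    (hθsq : ∀ x ∈ maximalIdeal S ^ 2, θ x = 0)
    (hψadd : ∀ x y : S, x ∈ maximalIdeal S → y ∈ maximalIdeal S → ψ (x + y) = ψ x + ψ y)
    (hψmul : ∀ s x : S, x ∈ maximalIdeal S → ψ (s * x) = residue S s * ψ x)
    (hψsq : ∀ x ∈ maximalIdeal S ^ 2, ψ x = 0)
    {G₁ G₂ : S[X]} (hG₁ : G₁ ∈ (maximalIdeal S).map (C : S →+* S[X])) (hG₂ : G₂ ∈ (maximalIdeal S).map (C : S →+* S[X]))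
    {A₁ A₂ B₁ B₂ : (ResidueField S)[X]}
    (hA₁ : ∀ n, A₁.coeff n = θ (G₁.coeff n)) (hA₂ : ∀ n, A₂.coeff n = θ (G₂.coeff n))
    (hB₁ : ∀ n, B₁.coeff n = ψ (G₁.coeff n)) (hB₂ : ∀ n, B₂.coeff n = ψ (G₂.coeff n))
    {a : S} (hΔ : A₁.eval (residue S a) * B₂.eval (residue S a) - A₂.eval (residue S a) * B₁.eval (residue S a) ≠ 0) :
    IsTwoFlag (Polynomial.aeval a G₁) (Polynomial.aeval a G₂) := by
  have hGa : ∀ {G : S[X]}, G ∈ (maximalIdeal S).map (C : S →+* S[X]) → Polynomial.aeval a G ∈ maximalIdeal S := by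
    intro G hG
    rw [Polynomial.aeval_eq_sum_range]
    exact Ideal.sum_mem _ fun i _ => by
      rw [smul_eq_mul]; exact Ideal.mul_mem_right _ _ ((Ideal.mem_map_C_iff.mp hG) i)
  refine ⟨hGa hG₁, hGa hG₂, fun c₁ c₂ hc => ?_⟩
  have key : ∀ {χ : S → ResidueField S},
      (∀ x y : S, x ∈ maximalIdeal S → y ∈ maximalIdeal S → χ (x + y) = χ x + χ y) →
      (∀ s x : S, x ∈ maximalIdeal S → χ (s * x) = residue S s * χ x) → (∀ x ∈ maximalIdeal S ^ 2, χ x = 0) →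
      ∀ {P₁ P₂ : (ResidueField S)[X]}, (∀ n, P₁.coeff n = χ (G₁.coeff n)) → (∀ n, P₂.coeff n = χ (G₂.coeff n)) →
        residue S c₁ * P₁.eval (residue S a) + residue S c₂ * P₂.eval (residue S a) = 0 := by
    intro χ hadd hmul hsq P₁ P₂ hP₁ hP₂
    rw [← cotangentFunctional_aeval hadd hmul hG₁ hP₁, ← cotangentFunctional_aeval hadd hmul hG₂ hP₂,
      ← hmul _ _ (hGa hG₁), ← hmul _ _ (hGa hG₂),
      ← hadd _ _ (Ideal.mul_mem_left _ _ (hGa hG₁)) (Ideal.mul_mem_left _ _ (hGa hG₂))]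
    exact hsq _ hc
  have h1 := key hθadd hθmul hθsq hA₁ hA₂
  have h2 := key hψadd hψmul hψsq hB₁ hB₂
  have hc₁ : residue S c₁ = 0 := by
    have : residue S c₁ * (A₁.eval (residue S a) * B₂.eval (residue S a) -
        A₂.eval (residue S a) * B₁.eval (residue S a)) = 0 := by
      linear_combination B₂.eval (residue S a) * h1 - A₂.eval (residue S a) * h2
    exact (mul_eq_zero.mp this).resolve_right hΔ
  have hc₂ : residue S c₂ = 0 := by
    have : residue S c₂ * (A₁.eval (residue S a) * B₂.eval (residue S a) -
        A₂.eval (residue S a) * B₁.eval (residue S a)) = 0 := by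
      linear_combination A₁.eval (residue S a) * h2 - B₁.eval (residue S a) * h1
    exact (mul_eq_zero.mp this).resolve_right hΔ
  exact ⟨(IsLocalRing.residue_eq_zero_iff _).mp hc₁, (IsLocalRing.residue_eq_zero_iff _).mp hc₂⟩

/-- **A nonzero cotangent minor exists** for a pair satisfying the polynomial flag condition (★): pick `θ` seeing a coefficient
of `G₁` outside `𝔪²`, lift `θG₁, θG₂` to `Q₁, Q₂ ∈ S[X]`; then `W = Q₁G₂ − Q₂G₁ ∉ 𝔪²S[X]` by (★) (else `Q₁ ∈ 𝔪S[X]`, `θG₁ = 0`),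
and a `ψ` seeing a coefficient of `W` outside `𝔪²` has `ψW = θG₁·ψG₂ − θG₂·ψG₁ ≠ 0`. [folklore] -/
theorem exists_minor_ne_zero {G₁ G₂ : S[X]}
    (hG₁ : G₁ ∈ (maximalIdeal S).map (C : S →+* S[X])) (hG₂ : G₂ ∈ (maximalIdeal S).map (C : S →+* S[X]))
    (hstar : ∀ P₁ P₂ : S[X], P₁ * G₁ + P₂ * G₂ ∈ (maximalIdeal S ^ 2).map (C : S →+* S[X]) →
      P₁ ∈ (maximalIdeal S).map (C : S →+* S[X]) ∧ P₂ ∈ (maximalIdeal S).map (C : S →+* S[X])) :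
    ∃ θ ψ : S → ResidueField S,
      (∀ x y : S, x ∈ maximalIdeal S → y ∈ maximalIdeal S → θ (x + y) = θ x + θ y) ∧
      (∀ s x : S, x ∈ maximalIdeal S → θ (s * x) = residue S s * θ x) ∧ (∀ x ∈ maximalIdeal S ^ 2, θ x = 0) ∧
      (∀ x y : S, x ∈ maximalIdeal S → y ∈ maximalIdeal S → ψ (x + y) = ψ x + ψ y) ∧
      (∀ s x : S, x ∈ maximalIdeal S → ψ (s * x) = residue S s * ψ x) ∧ (∀ x ∈ maximalIdeal S ^ 2, ψ x = 0) ∧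
      ∃ A₁ A₂ B₁ B₂ : (ResidueField S)[X],
        (∀ n, A₁.coeff n = θ (G₁.coeff n)) ∧ (∀ n, A₂.coeff n = θ (G₂.coeff n)) ∧
        (∀ n, B₁.coeff n = ψ (G₁.coeff n)) ∧ (∀ n, B₂.coeff n = ψ (G₂.coeff n)) ∧
        A₁ * B₂ - A₂ * B₁ ≠ 0 := by
  classical
  -- `G₁ ∉ 𝔪²S[X]`: else `1·G₁ + 0·G₂ ∈ 𝔪²S[X]` forces `1 ∈ 𝔪S[X]`.
  have hG₁sq : G₁ ∉ (maximalIdeal S ^ 2).map (C : S →+* S[X]) := by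
    intro h1
    have h := (hstar 1 0 (by rwa [one_mul, zero_mul, add_zero])).1
    exact (Ideal.IsPrime.ne_top inferInstance) (Ideal.eq_top_of_isUnit_mem _ h isUnit_one)
  obtain ⟨m, hm⟩ : ∃ m, G₁.coeff m ∉ maximalIdeal S ^ 2 := by
    by_contra hall
    simp only [not_exists, not_not] at hall
    exact hG₁sq (Ideal.mem_map_C_iff.mpr hall)
  obtain ⟨θ, hθadd, hθmul, hθsq, hθm⟩ := exists_cotangentFunctional_ne_zero ((Ideal.mem_map_C_iff.mp hG₁) m) hm
  obtain ⟨A₁, hA₁⟩ := exists_cotangentFunctional_transform hθmul G₁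
  obtain ⟨A₂, hA₂⟩ := exists_cotangentFunctional_transform hθmul G₂
  have hA₁ne : A₁ ≠ 0 := fun h0 => hθm (by rw [← hA₁, h0, Polynomial.coeff_zero])
  obtain ⟨Q₁, hQ₁⟩ := Polynomial.map_surjective (residue S) IsLocalRing.residue_surjective A₁
  obtain ⟨Q₂, hQ₂⟩ := Polynomial.map_surjective (residue S) IsLocalRing.residue_surjective A₂
  -- `W := Q₁ G₂ - Q₂ G₁ ∉ 𝔪²S[X]`
  have hW : Q₁ * G₂ - Q₂ * G₁ ∉ (maximalIdeal S ^ 2).map (C : S →+* S[X]) := by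
    intro hW
    have h := (hstar (-Q₂) Q₁ (by rwa [neg_mul, add_comm, ← sub_eq_add_neg])).2
    exact hA₁ne (by rw [← hQ₁, map_residue_eq_zero_of_mem h])
  have hWmem : Q₁ * G₂ - Q₂ * G₁ ∈ (maximalIdeal S).map (C : S →+* S[X]) :=
    Ideal.sub_mem _ (Ideal.mul_mem_left _ _ hG₂) (Ideal.mul_mem_left _ _ hG₁)
  obtain ⟨m', hm'⟩ : ∃ m', (Q₁ * G₂ - Q₂ * G₁).coeff m' ∉ maximalIdeal S ^ 2 := by
    by_contra hall
    simp only [not_exists, not_not] at hall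
    exact hW (Ideal.mem_map_C_iff.mpr hall)
  obtain ⟨ψ, hψadd, hψmul, hψsq, hψm⟩ := exists_cotangentFunctional_ne_zero ((Ideal.mem_map_C_iff.mp hWmem) m') hm'
  obtain ⟨B₁, hB₁⟩ := exists_cotangentFunctional_transform hψmul G₁
  obtain ⟨B₂, hB₂⟩ := exists_cotangentFunctional_transform hψmul G₂
  refine ⟨θ, ψ, hθadd, hθmul, hθsq, hψadd, hψmul, hψsq, A₁, A₂, B₁, B₂, hA₁, hA₂, hB₁, hB₂, fun h0 => hψm ?_⟩
  -- `ψ(W_{m'}) = (A₁ B₂ - A₂ B₁)_{m'} = 0`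
  have hGc₁ := Ideal.mem_map_C_iff.mp hG₁
  have hGc₂ := Ideal.mem_map_C_iff.mp hG₂
  rw [Polynomial.coeff_sub, cotangentFunctional_sub hψadd hψmul, cotangentFunctional_coeff_mul hψadd hψmul Q₁ hG₂ hB₂,
    cotangentFunctional_coeff_mul hψadd hψmul Q₂ hG₁ hB₁, hQ₁, hQ₂, ← Polynomial.coeff_sub, h0, Polynomial.coeff_zero]
  · rw [Polynomial.coeff_mul]
    exact Ideal.sum_mem _ fun x _ => Ideal.mul_mem_left _ _ (hGc₂ x.2)
  · rw [Polynomial.coeff_mul]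
    exact Ideal.sum_mem _ fun x _ => Ideal.mul_mem_left _ _ (hGc₁ x.2)

end Minor

section Infinite

variable {S : Type} [CommRing S] [IsLocalRing S]

/-- **FLAGS OF `S(X)` WITH POLYNOMIAL MEMBERS SPECIALISE (infinite residue field)** — the hypothesis `hspec` of
`WeightedInvariantIota3SigmaDescentSX`: off the finite set `B ∪ {roots of Δ}` every residue `ā` gives a two-flag
`(G₁(a), G₂(a))` of `S`. [folklore] -/
theorem isTwoFlag_specialises_of_infinite [Infinite (ResidueField S)] (G₁ G₂ : S[X])
    (h : IsTwoFlag (algebraMap S[X] (Localization.AtPrime ((maximalIdeal S).map (C : S →+* S[X]))) G₁)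
      (algebraMap S[X] (Localization.AtPrime ((maximalIdeal S).map (C : S →+* S[X]))) G₂))
    (B : Finset (ResidueField S)) :
    ∃ a : S, residue S a ∉ B ∧ IsTwoFlag (Polynomial.aeval a G₁) (Polynomial.aeval a G₂) := by
  classical
  obtain ⟨hG₁, hG₂, hstar⟩ := isTwoFlag_genericFibre_polynomial h
  obtain ⟨θ, ψ, hθadd, hθmul, hθsq, hψadd, hψmul, hψsq, A₁, A₂, B₁, B₂, hA₁, hA₂, hB₁, hB₂, hΔ⟩ :=
    exists_minor_ne_zero hG₁ hG₂ hstar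
  obtain ⟨r, hr⟩ := Infinite.exists_notMem_finset (B ∪ (A₁ * B₂ - A₂ * B₁).roots.toFinset)
  obtain ⟨a, rfl⟩ := IsLocalRing.residue_surjective r
  rw [Finset.mem_union, not_or, Multiset.mem_toFinset, Polynomial.mem_roots hΔ] at hr
  refine ⟨a, hr.1, isTwoFlag_aeval_of_minor_ne_zero hθadd hθmul hθsq hψadd hψmul hψsq hG₁ hG₂ hA₁ hA₂ hB₁ hB₂ ?_⟩
  intro h0
  apply hr.2
  rw [Polynomial.IsRoot.def, Polynomial.eval_sub, Polynomial.eval_mul, Polynomial.eval_mul]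
  exact h0

/-- **DESCENT of reached weights along `S → S(X)`** for an infinite residue field. [folklore] -/
theorem FlagReaches.of_genericFibre [Infinite (ResidueField S)] {f : S} {ν q r₁ r₂ : ℕ}
    (h : FlagReaches (algebraMap S[X] (Localization.AtPrime ((maximalIdeal S).map (C : S →+* S[X]))) (C f)) ν q r₁ r₂) :
    FlagReaches f ν q r₁ r₂ :=
  FlagReaches.of_genericFibre_of_spec (fun G₁ G₂ hG B => isTwoFlag_specialises_of_infinite G₁ G₂ hG B) h

/-- `FlagReaches` is an `iff` along `S → S(X)` for an infinite residue field. [folklore] -/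
theorem flagReaches_genericFibre_iff [Infinite (ResidueField S)] (f : S) (ν q r₁ r₂ : ℕ) :
    FlagReaches (algebraMap S[X] (Localization.AtPrime ((maximalIdeal S).map (C : S →+* S[X]))) (C f)) ν q r₁ r₂ ↔
      FlagReaches f ν q r₁ r₂ :=
  flagReaches_genericFibre_iff_of_spec (fun G₁ G₂ hG B => isTwoFlag_specialises_of_infinite G₁ G₂ hG B) f ν q r₁ r₂

/-- **`σ` IS PRESERVED ALONG `S → S(X) = S[X]_{𝔪S[X]}` for every local ring `S` with INFINITE residue field** (unconditional;
ascent p530558/p534437, descent by specialisation of flags p536350/p538474 + this file). [folklore] -/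
theorem iotaSigma_genericFibre_eq [Infinite (ResidueField S)] (f : S) :
    iotaSigma (Localization.AtPrime ((maximalIdeal S).map (C : S →+* S[X])))
        (algebraMap S[X] (Localization.AtPrime ((maximalIdeal S).map (C : S →+* S[X]))) (C f)) = iotaSigma S f :=
  iotaSigma_genericFibre_eq_of_spec (fun G₁ G₂ hG B => isTwoFlag_specialises_of_infinite G₁ G₂ hG B) f

/-- The same with the structure map `S → S(X)` on the left. [folklore] -/
theorem iotaSigma_algebraMap_genericFibre_eq [Infinite (ResidueField S)] (f : S) :
    iotaSigma (Localization.AtPrime ((maximalIdeal S).map (C : S →+* S[X])))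
        (algebraMap S (Localization.AtPrime ((maximalIdeal S).map (C : S →+* S[X]))) f) = iotaSigma S f := by
  rw [algebraMap_genericFibre_apply]
  exact iotaSigma_genericFibre_eq f

end Infinite

end Iota3

end Summit.ResolutionOfSingularities.ResolutionOfSingularities.Cruxes.HypersurfaceCentreConstruction.LocalEngine
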